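import Summits.ResolutionOfSingularities.ResolutionOfSingularities.Theorems.SubfieldContactFrames
import HarnessLib

/-!
# SubfieldContactAbs — decomp-res node «SubfieldContact» (lens-6 g19, critic rows 147/147b), tree file 3/5 of the node

Content VERBATIM from the decomp-res lens-6 g19 node file `HOME/decomp-res-lens-6/g19/SubfieldContact.lean` (rev 1
pin ba733ec4…, 855 l;
= `parts/SubfieldContact-g19-rev1-ba733ec4.lean`; HOME = run/shared/lean/pub/decomp-res).  Critic: CRITIC-LEDGER
rows 147 (node 90f156f3 CLEARED) and 147b
(rev 1 = MAP +1, window (M2) consumed; «rev 1 ba733ec4 SUPERSEDES 90f156f3 as the source of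
Theorems/SubfieldContactClasses», order 2026-08-30T22:19:25Z).
Landed by decomp-res writer g8 in the lens's namespace `…Theorems.SubfieldContactClasses`, split CONE-AWARE for
the 400-line limit: `SubfieldContactClasses`
(§1–§6), `SubfieldContactFrames` (§7), `SubfieldContactAbs` (§8–§9), `SubfieldContactPowAdjoin` (§10) are
OUTSIDE the Theses cone (the lens's cone import
`MaxContactCutTauLadder` is used only by the «…_of_items» / «…_of_pieces» up-links from the MaxContactCut
items, which live in the in-cone wiring file
`MaxContactCutSubfieldContact`).  All `--supports stmt-ResolutionOfSingularities-29273` (`RungOne` = `E 2 → E 1`).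
 Route bookkeeping (critic rows 147/147b):
ONE located-residual aside `E1NoSubDvd` (home `SubfieldContactClasses`) on 29273; the NEW LEMMA `SubfieldContactAbs`
(skeleton §9 BY NAME: stubs
`StalkSubfieldContactAbs` / `ContactSpreads` / `SubfieldContactGlue`, `PowAdjoinBase` PROVED by
`powAdjoinBase_holds`) is booked as the prover target (kind aside
under the NAMED-RUNG RULE — outside the cone of `closes`); `SubfieldContact` is its kernel corollary
(`subfieldContact_of_abs`) and is NOT served separately.

§8 (rev 1, window (M2)) THE WILD RESIDUAL RE-TYPED EXACTLY BY ABSOLUTE STALK CONTACT: `TopNoAbsContact`,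
`WORTopNoAbs` / `WORAllAbs` / `E1TopNoAbs` /
`E1AllAbs`, hypothesis-free kernels `not_hasSubfieldContact_of_topNoAbsContact`, `dvd_of_topNoAbsContact`,
`worTopNoAbs_of_worNoSubDvd`; the spreading
lemma `SubfieldContactAbs` (@[conjecture] def; THE booked prover target) with `subfieldContact_of_abs`, the EXACT
`e1NoSubDvd_iff_e1TopNoAbs (hS)`,
`e_one_iff_topNoAbs`; §8b `TopPPower ⊆` the residual (`worTopPPower_of_worNoSubDvd`); §9 the skeleton at all
markings: `StalkSubfieldContactAbs`,
`stalkSubfieldContact_of_abs`, `subfieldContactAbs_of_pieces`.  Up-links `…_of_items` /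
`e_one_iff_topNoAbs_of_pieces` in `MaxContactCutSubfieldContact`.
0 sorry.  Imports `SubfieldContactFrames`.  Cone-free.

[WRITER NOTE (decomp-res writer g8): section split only; namespace, opens, section variables and every declaration
exactly as in the lens (global
`set_option` dropped; the cone import replaced in the cone-free files by the cone-free `WeakOrderReduction`, already
under `PurityValveClasses`).]

(Sources: EGAIV4 §16.8; Matsumura1987 §26, Thm 30.6; Giraud1975; EncinasVillamayor2000GoodPoints §4;
BierstoneGrigorievMilmanWlodarczyk2011 §3; CossartJannsenSaito2020 Thm 1.4; CossartPiltant2008I Thm 2.1;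
Cossart2011WeakMaximalContact; CossartPiltant2019; Kollar2007 §3.9.)
-/

noncomputable section

namespace Summit.ResolutionOfSingularities.ResolutionOfSingularities.Theorems.SubfieldContactClasses

open CategoryTheory AlgebraicGeometry TopologicalSpace
open Literature.AlgebraicGeometry.Resolution
open Summit.ResolutionOfSingularities.ResolutionOfSingularities.Theorems
open WeakOrderReduction ForcedTowerClasses PurityValveClasses

/-! ## §8 (rev 1 · after CRITIC-LEDGER row 147, window g20 item (M2)) THE WILD RESIDUAL RE-TYPED EXACTLY BY ABSOLUTE
STALK CONTACT.  Second typing of the located residual: `WORTopNoAbs n` = weak order reduction for the data having a CLOSED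
top point WITHOUT absolute stalk contact (generation 17's field-free `IsAbsContactAt`).  KERNEL: (i) hypothesis-free,
`WORNoSubDvd n → WORTopNoAbs n` (a closed top point without absolute stalk contact forces `p ∣ n` by generation 18's
`isAbsContactAt_of_not_dvd` and forbids subfield contact over ANY field structure, relative operators being absolute ones:
tree `isAbsContactAt_of_isContactPt`); (ii) EXACT modulo the spreading lemma `SubfieldContactAbs` (= steps (2)–(5) of §3,
which never use `p ∤ n`, fed at the closed top points by absolute stalk contact): `WORNoSubDvd n ⟺ WORTopNoAbs n`,
`E1NoSubDvd ⟺ E1TopNoAbs`, `E 1 ⟺ E1TopNoAbs` modulo `SubfieldContactAbs ∧ E 5`; (iii) `SubfieldContactAbs ⟹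
SubfieldContact` in kernel; (iv) every datum with a closed top point in lens-4's `p`-POWER FORM lies in the re-typed
residual (tree `not_isAbsContactAt_of_pPowerFormAt`); the converse inclusion is the every-field dictionary of the g19
COMPANION «ContactFreeIsPPower» (`isAbsContactAt_iff_not_pPowerFormAt_closed`, separate tree file). -/

/-- **`TopNoAbsContact Y 𝓘 n`** — the datum has a CLOSED top point (`ord_y 𝓘 = n`) WITHOUT absolute stalk contact
(`¬ IsAbsContactAt 𝓘 n y`: no absolute differential operator of order `< n` on `𝒪_{Y,y}` sends an element of
`𝓘_y` into
`𝔪_y ∖ 𝔪_y²`). DEFINITION (support). -/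
def TopNoAbsContact (Y : Scheme.{0}) (I : Y.IdealSheafData) (n : ℕ) : Prop :=
  ∃ y : Y, IsClosed ({y} : Set Y) ∧ idealOrder I y = ((n : ℕ) : ℕ∞) ∧ ¬ AbsoluteContactClasses.IsAbsContactAt I n y

/-- **hypothesis-free**: a closed top point without absolute stalk contact rules out subfield contact over ANY field
structure (a relative differential operator is an absolute one: tree `isAbsContactAt_of_isContactPt`). [folklore] -/
theorem not_hasSubfieldContact_of_topNoAbsContact {p : ℕ} {Y : Scheme.{0}} {I : Y.IdealSheafData} {n : ℕ}
    (h : TopNoAbsContact Y I n) : ¬ HasSubfieldContact p Y I n := by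
  rintro ⟨F, _, _, f, -, hlft, -, hc⟩
  obtain ⟨y, -, hord, hna⟩ := h
  haveI := hlft
  exact hna (AbsoluteContactClasses.isAbsContactAt_of_isContactPt f I n y (hc y hord))

/-- **hypothesis-free**: a closed top point without absolute stalk contact forces `p ∣ n` (generation 18's
`isAbsContactAt_of_not_dvd`: prime to `p`, closed top points over ANY field have absolute stalk contact). [folklore] -/
theorem dvd_of_topNoAbsContact {p : ℕ} (hp : p.Prime) {n : ℕ} (hn : 1 ≤ n) {k : Type} [Field k] [CharP k p]
    {Y : Scheme.{0}} (g : Y ⟶ Spec (.of k)) (hB : IsBase Y g) {I : Y.IdealSheafData} (h : TopNoAbsContact Y I n) :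
    p ∣ n := by
  by_contra hpn
  obtain ⟨y, hyc, hord, hna⟩ := h
  exact hna (AbsoluteContactClasses.isAbsContactAt_of_not_dvd hp hn hpn Y g hB I y hyc hord)

/-- **THE WILD RESIDUAL, SECOND TYPING · `WORTopNoAbs n`** — weak order reduction at marking `n` (dim ≤ 4, any field, any
boundary) for the data having a closed top point WITHOUT absolute stalk contact. DEFINITION (located residual). -/
def WORTopNoAbs (n : ℕ) : Prop :=
  ∀ p : ℕ, p.Prime → ∀ (k : Type) [Field k] [CharP k p] (Y : Scheme.{0}) (g : Y ⟶ Spec (.of k)),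
    IsBase Y g → ∀ M : MarkedIdeal Y, IsDatum n M → TopNoAbsContact Y M.ideal n →
      ∃ t : CentreSeq Y, WeakResolution t M

/-- **piece · `WORAllAbs n`** — the complement: data all of whose closed top points HAVE absolute stalk contact.
DEFINITION (support). -/
def WORAllAbs (n : ℕ) : Prop :=
  ∀ p : ℕ, p.Prime → ∀ (k : Type) [Field k] [CharP k p] (Y : Scheme.{0}) (g : Y ⟶ Spec (.of k)),
    IsBase Y g → ∀ M : MarkedIdeal Y, IsDatum n M → ¬ TopNoAbsContact Y M.ideal n →
      ∃ t : CentreSeq Y, WeakResolution t M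

/-- The families over all markings `n ≥ 1`. -/
def E1TopNoAbs : Prop := ∀ n : ℕ, 1 ≤ n → WORTopNoAbs n

/-- see `E1TopNoAbs`. -/
def E1AllAbs : Prop := ∀ n : ℕ, 1 ≤ n → WORAllAbs n

/-- **EXACT CARVE (second typing) at one marking**: `WOR n ⟺ WORAllAbs n ∧ WORTopNoAbs n`. [folklore] -/
theorem wor_iff_allAbs_topNoAbs (n : ℕ) : WOR n ↔ WORAllAbs n ∧ WORTopNoAbs n := by
  constructor
  · intro h
    exact ⟨fun p hp k _ _ Y g hB M hM _ => h p hp k Y g hB M hM,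
      fun p hp k _ _ Y g hB M hM _ => h p hp k Y g hB M hM⟩
  · rintro ⟨hA, hN⟩ p hp k _ _ Y g hB M hM
    by_cases htop : TopNoAbsContact Y M.ideal n
    · exact hN p hp k Y g hB M hM htop
    · exact hA p hp k Y g hB M hM htop

/-- **EXACT CARVE (second typing) of the family**: `E 1 ⟺ E1AllAbs ∧ E1TopNoAbs`. [folklore] -/
theorem e_one_iff_allAbs_topNoAbs : E 1 ↔ E1AllAbs ∧ E1TopNoAbs := by
  constructor
  · intro h
    exact ⟨fun n hn => ((wor_iff_allAbs_topNoAbs n).1 (wor_of_seqDimFour_one (h n hn))).1,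
      fun n hn => ((wor_iff_allAbs_topNoAbs n).1 (wor_of_seqDimFour_one (h n hn))).2⟩
  · rintro ⟨hA, hN⟩ n hn
    exact seqDimFour_one_of_wor ((wor_iff_allAbs_topNoAbs n).2 ⟨hA n hn, hN n hn⟩)

/-- **(M2), HYPOTHESIS-FREE HALF**: the first typing of the residual contains the second —
`WORNoSubDvd n → WORTopNoAbs n`. [folklore] -/
theorem worTopNoAbs_of_worNoSubDvd {n : ℕ} (hn : 1 ≤ n) (h : WORNoSubDvd n) : WORTopNoAbs n := by
  intro p hp k _ _ Y g hB M hM htop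
  exact h p hp (dvd_of_topNoAbsContact hp hn g hB htop) k Y g hB M hM
    (not_hasSubfieldContact_of_topNoAbsContact htop)

/-- … for the families: `E1NoSubDvd → E1TopNoAbs`. [folklore] -/
theorem e1TopNoAbs_of_e1NoSubDvd (h : E1NoSubDvd) : E1TopNoAbs :=
  fun n hn => worTopNoAbs_of_worNoSubDvd hn (h n hn)

/-- The second typing is a consequence of the host, hypothesis-free. [folklore] -/
theorem e1TopNoAbs_of_e_one (h : E 1) : E1TopNoAbs :=
  e1TopNoAbs_of_e1NoSubDvd (e1NoSubDvd_of_e_one h)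

/-- **THE SPREADING LEMMA · `SubfieldContactAbs`** [paper proof = NODE-g19 §3 steps (2)–(5) VERBATIM (they never use
`p ∤ n`), step (1) replaced by: at a closed top point WITH absolute stalk contact the initial ideal is not a `p`-power form
(tree `not_isAbsContactAt_of_pPowerFormAt`, contrapositive of the companion's every-field dictionary), so the `p^n`-frame of
generation 18 adapted to a cofinite part `Λ` of the absolute `p`-basis `B` carries a Hasse–Schmidt coefficient `Δ_α`,
`|α| ≤ n - 1`, with `Δ_α h ∈ 𝔪_y ∖ 𝔪_y²` (lens-4's ring dictionary
`exists_mem_diffIdeal_of_not_pPower`), and `Δ_α` is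
`𝒪_y^{p^n}[b]`-linear, hence `k^{(p^n)}(Λ)`-linear; kernel UNDECIDED · ATTACKABLE-L] — «ANY marking `n ≥
1`, ANY field:
if every CLOSED top point has absolute stalk contact, the datum has subfield contact».  It implies `SubfieldContact`
(`subfieldContact_of_abs`). (Sources: Matsumura1987, §26 and Thm 30.6; EGAIV4, 16.8.2 and 16.8.8.) -/
@[conjecture]
def SubfieldContactAbs : Prop :=
  ∀ p : ℕ, p.Prime → ∀ n : ℕ, 1 ≤ n → ∀ (k : Type) [Field k] [CharP k p] (Y : Scheme.{0}) (g : Y ⟶ Spec (.of k)),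
    IsBase Y g → ∀ I : Y.IdealSheafData, (∀ y : Y, idealOrder I y ≤ ((n : ℕ) : ℕ∞)) →
      (∀ y : Y, IsClosed ({y} : Set Y) → idealOrder I y = ((n : ℕ) : ℕ∞) →
        AbsoluteContactClasses.IsAbsContactAt I n y) →
      HasSubfieldContact p Y I n

/-- **kernel**: the spreading lemma implies the new lemma of §4 (prime to `p` every closed top point has absolute stalk
contact, generation 18). [folklore] -/
theorem subfieldContact_of_abs (h : SubfieldContactAbs) : SubfieldContact :=
  fun p hp n hn hpn k _ _ Y g hB I hI =>
    h p hp n hn k Y g hB I hI fun y hyc hy => AbsoluteContactClasses.isAbsContactAt_of_not_dvd hp hn hpn Y g hB I y hyc hy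

/-- **(M2), THE OTHER HALF modulo the spreading lemma**: `WORTopNoAbs n → WORNoSubDvd n`. [folklore] -/
theorem worNoSubDvd_of_worTopNoAbs (hS : SubfieldContactAbs) {n : ℕ} (hn : 1 ≤ n) (h : WORTopNoAbs n) :
    WORNoSubDvd n := by
  intro p hp _ k _ _ Y g hB M hM hno
  by_cases htop : TopNoAbsContact Y M.ideal n
  · exact h p hp k Y g hB M hM htop
  · exact absurd (hS p hp n hn k Y g hB M.ideal hM.2 fun y hyc hy =>
      Classical.by_contradiction fun hna => htop ⟨y, hyc, hy, hna⟩) hno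

/-- **(M2) · THE WILD RESIDUAL RE-TYPED EXACTLY**: `WORNoSubDvd n ⟺ WORTopNoAbs n` modulo `SubfieldContactAbs`
(`n ≥ 1`; ⟹ hypothesis-free). [folklore] -/
theorem worNoSubDvd_iff_worTopNoAbs (hS : SubfieldContactAbs) {n : ℕ} (hn : 1 ≤ n) :
    WORNoSubDvd n ↔ WORTopNoAbs n :=
  ⟨worTopNoAbs_of_worNoSubDvd hn, worNoSubDvd_of_worTopNoAbs hS hn⟩

/-- **(M2) for the family**: `E1NoSubDvd ⟺ E1TopNoAbs` modulo `SubfieldContactAbs` (⟹ hypothesis-free,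
`e1TopNoAbs_of_e1NoSubDvd`). [folklore] -/
theorem e1NoSubDvd_iff_e1TopNoAbs (hS : SubfieldContactAbs) : E1NoSubDvd ↔ E1TopNoAbs :=
  ⟨e1TopNoAbs_of_e1NoSubDvd, fun h n hn => worNoSubDvd_of_worTopNoAbs hS hn (h n hn)⟩

/-- The complement is lens-5's class: data all of whose closed top points have absolute stalk contact have subfield
contact (spreading lemma), hence are resolved by `SeqDimFour 5 n` (§3). [folklore] -/
theorem worAllAbs_of_five (hS : SubfieldContactAbs) {n : ℕ} (hn : 1 ≤ n) (h5 : SeqDimFour 5 n) : WORAllAbs n := by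
  intro p hp k _ _ Y g hB M hM htop
  exact worSub_of_seqDimFour_five h5 p hp k Y g hB M hM (hS p hp n hn k Y g hB M.ideal hM.2 fun y hyc hy =>
    Classical.by_contradiction fun hna => htop ⟨y, hyc, hy, hna⟩)

/-- **THE CONE EDGE, second typing**: `E 1 ⟺ E1TopNoAbs` modulo `SubfieldContactAbs` and `E 5`. [folklore] -/
theorem e_one_iff_topNoAbs (hS : SubfieldContactAbs) (h5 : E 5) : E 1 ↔ E1TopNoAbs :=
  ⟨e1TopNoAbs_of_e_one, fun h => e_one_iff_allAbs_topNoAbs.2 ⟨fun n hn => worAllAbs_of_five hS hn (h5 n hn), h⟩⟩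

/-! ### §8b The re-typed residual contains every datum with a closed top point in `p`-POWER FORM (lens-4's object) -/

/-- **`TopPPower p Y 𝓘 n`** — the datum has a CLOSED top point whose initial ideal is a `p`-power form (lens-4 g23
`PPowerFormAt`). DEFINITION (support). -/
def TopPPower (p : ℕ) (Y : Scheme.{0}) (I : Y.IdealSheafData) (n : ℕ) : Prop :=
  ∃ y : Y, IsClosed ({y} : Set Y) ∧ idealOrder I y = ((n : ℕ) : ℕ∞) ∧ HugValuationCut.PPowerFormAt p I n y

/-- **kernel, hypothesis-free**: a closed top point in `p`-power form is a closed top point without absolute stalk contact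
(lens-4's `not_isAbsContactAt_of_pPowerFormAt`; the stalk has characteristic `p` through the structure field). [folklore] -/
theorem topNoAbsContact_of_topPPower {p : ℕ} (hp : p.Prime) {k : Type} [Field k] [CharP k p] {Y : Scheme.{0}}
    (g : Y ⟶ Spec (.of k)) {I : Y.IdealSheafData} {n : ℕ} (hn : 1 ≤ n) (h : TopPPower p Y I n) :
    TopNoAbsContact Y I n := by
  obtain ⟨y, hyc, hord, hpp⟩ := h
  letI := stalkAlgebra (g.appTop.hom.comp (Scheme.ΓSpecIso (.of k)).inv.hom) y
  haveI : CharP (Y.presheaf.stalk y) p :=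
    charP_of_injective_algebraMap (algebraMap k (Y.presheaf.stalk y)).injective p
  haveI : Fact p.Prime := ⟨hp⟩
  exact ⟨y, hyc, hord, HugValuationCut.not_isAbsContactAt_of_pPowerFormAt hn hpp⟩

/-- **`WORTopPPower n`** — weak order reduction for the data with a closed top point in `p`-power form: lens-4's `p`-power
object read on the `E 1` side. DEFINITION (support). -/
def WORTopPPower (n : ℕ) : Prop :=
  ∀ p : ℕ, p.Prime → ∀ (k : Type) [Field k] [CharP k p] (Y : Scheme.{0}) (g : Y ⟶ Spec (.of k)),
    IsBase Y g → ∀ M : MarkedIdeal Y, IsDatum n M → TopPPower p Y M.ideal n →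
      ∃ t : CentreSeq Y, WeakResolution t M

/-- **kernel, hypothesis-free**: the re-typed residual serves every `p`-power-form datum — `WORTopNoAbs n → WORTopPPower n`
(the converse inclusion of classes is the companion's every-field dictionary at closed points). [folklore] -/
theorem worTopPPower_of_worTopNoAbs {n : ℕ} (hn : 1 ≤ n) (h : WORTopNoAbs n) : WORTopPPower n :=
  fun p hp k _ _ Y g hB M hM htop => h p hp k Y g hB M hM (topNoAbsContact_of_topPPower hp g hn htop)

/-- … and so does the first typing, hypothesis-free: `WORNoSubDvd n → WORTopPPower n`. [folklore] -/
theorem worTopPPower_of_worNoSubDvd {n : ℕ} (hn : 1 ≤ n) (h : WORNoSubDvd n) : WORTopPPower n :=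
  worTopPPower_of_worTopNoAbs hn (worTopNoAbs_of_worNoSubDvd hn h)

/-! ## §9 (rev 1) Typed attack plan for the spreading lemma `SubfieldContactAbs`: the core at ALL markings and the
kernel-checked composition (pieces F, L2, C of §7 are reused VERBATIM — they never use `p ∤ n`) -/

/-- **PIECE L1-abs · `StalkSubfieldContactAbs` — THE CORE AT ALL MARKINGS**: for an absolute `p`-basis `B` of `k` and a
CLOSED point `y` with `ord_y 𝓘 = n` and ABSOLUTE STALK CONTACT, finitely many `b ∈ B` aside, `y` is a contact point AT THE
STALK over `k^{(p^n)}(B ∖ S)` (paper: `¬ PPowerFormAt` by `not_isAbsContactAt_of_pPowerFormAt`; generation 18's frame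
`hasQFrames` adapted to a cofinite `Λ ⊆ B`; the companion's Hasse–Schmidt system over the prime field and lens-4's
`exists_mem_diffIdeal_of_not_pPower`; the coefficient `Δ_α` is `𝒪_y^{p^n}[b]`-linear). [UNDECIDED(kernel) · ATTACKABLE] -/
def StalkSubfieldContactAbs : Prop :=
  ∀ p : ℕ, p.Prime → ∀ n : ℕ, 1 ≤ n → ∀ (k : Type) [Field k] [CharP k p] (Y : Scheme.{0})
    (g : Y ⟶ Spec (.of k)), IsBase Y g → ∀ I : Y.IdealSheafData, ∀ B : Set k, IsPBasis p k B →
      ∀ y : Y, IsClosed ({y} : Set Y) → idealOrder I y = ((n : ℕ) : ℕ∞) →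
        AbsoluteContactClasses.IsAbsContactAt I n y →
          ∃ S : Finset k, (↑S : Set k) ⊆ B ∧ IsStalkContactPt (strOver g (powAdjoin k (p ^ n) (B \ ↑S))) I n y

/-- **kernel**: the core at all markings implies the core of §7 prime to `p` (generation 18). [folklore] -/
theorem stalkSubfieldContact_of_abs (h : StalkSubfieldContactAbs) : StalkSubfieldContact :=
  fun p hp n hn hpn k _ _ Y g hB I B hBasis y hyc hy =>
    h p hp n hn k Y g hB I B hBasis y hyc hy (AbsoluteContactClasses.isAbsContactAt_of_not_dvd hp hn hpn Y g hB I y hyc hy)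

/-- **THE COMPOSITION FOR THE SPREADING LEMMA (kernel, 0 sorry)**: `StalkSubfieldContactAbs → PowAdjoinBase →
ContactSpreads → SubfieldContactGlue → SubfieldContactAbs`. [folklore] -/
theorem subfieldContactAbs_of_pieces (hL1 : StalkSubfieldContactAbs) (hF : PowAdjoinBase) (hL2 : ContactSpreads)
    (hC : SubfieldContactGlue) : SubfieldContactAbs := by
  intro p hp n hn k _ _ Y g hB I hord habs
  obtain ⟨B, hBasis⟩ := exists_isPBasis hp k
  refine hC p hp n hn k Y g hB I hord B hBasis fun y hyc hy => ?_
  obtain ⟨S, hSB, hst⟩ := hL1 p hp n hn k Y g hB I B hBasis y hyc hy (habs y hyc hy)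
  obtain ⟨-, hlft, -⟩ := hF p hp n hn k Y g hB B hBasis S hSB
  obtain ⟨U, hyU, hU⟩ := hL2 (↥(powAdjoin k (p ^ n) (B \ ↑S))) Y (strOver g (powAdjoin k (p ^ n) (B \ ↑S))) hlft
    hB.isRegular I n hn hord y hy hst
  exact ⟨S, hSB, U, hyU, hU⟩

end Summit.ResolutionOfSingularities.ResolutionOfSingularities.Theorems.SubfieldContactClasses
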